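import Summits.Ventures.HodgeRepro.RouteCClauses
import Summits.Ventures.HodgeRepro.RouteCFaceC2C2C2

/-!
# The sixfold `A × E × E′` (the route's cheapest falsifier of C5′) discharged end to end from the printed
clauses, at `p = 6`

Blind re-derivation cell `pub-hodge-repro`, seat `night-1`.  `RouteCClauses.routeC_closes_face` is
instantiated on the face `(Φ_E; π, π′)` of `RouteCFaceC2C2C2.lean` (sealed row `Octic.Triquadratic`,
representative `(85, 3, 12)`; `B ≅ E⁴ × A² × E′⁴`, `B_red = E × A × E′`, three classes with right
stabilisers of orders `4, 1, 4`, `g = 6`, `k = 2`, `p = 6`).  This is exactly the instance `ROUTE.md` §4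
item 1 names as the first genuine test of Route C («a degree-8 face with `p = 6`: check that the sixfold
`A × E × E′` is an Albanese factor of a compact `U(6,1)` Shimura variety … Liu Cor 4.20 with `Φ_μ` running
over the three types lifted to `E` — a half-page check on reflex fields»).

**Load-bearing printed clauses for THIS face, with the parameters at which they are used**:

| clause | used at | what the model supplies |
|---|---|---|
| BMM 2016 Cor 2 (CONDITIONAL as printed, O-R2.3) | `(p, n) = (6, 2)`: `3k = 6 = p`, the BOUNDARY of the closed range `[0, p/3]` | `bmm_range_face` |
| DR 2015 Lemma 3.5 | the three CM types `Φ_E`, `Φ_A`, `Φ_{E′}` themselves (`liuType Φ = Φ` on `(ℤ/2)³`) | `liuType_reps`, `isCMType_liuType_reps` |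
| Liu 2021 Cor 4.20 | rank `n = 7 ≥ 3`; the characters `μ_E`, `μ_A`, `μ_{E′}` | `three_le_n` |
| Liu Def 4.5 + Shimura §8.3 | reflex fields `k`, `F`, `k′` (stabilisers of orders `4`, `1`, `4`) — `A_μ ∼ E^d`, `A^d`, `E′^d` | `reflexStab_liuType_reps`, `card_reflexStab_liuType_Φ_E` |
| R5 (Lemma W, kernel core) | `g = 1 + 4 + 1 = 6 ≤ p = 6`: `f : S′ → E × A × E′` generically finite | `sum_dim_simple` |
| R7 (Meng L4.1 / Tankeev Cor 1.2, codim-wise) | codimension `2` | — |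
| Lemma R (S3ᴿ), CM-ALGEBRA side | the reduced sets in `G/H ⊔ G ⊔ G/H′`, Pohlmann for `E × A × E′` | `isHodgeSetOn_cosetMap_reducedSet_face`, `injOn_cosetMap_reducedSet` |

Compared with the `C8` face (`RouteCFaceC8Discharge.lean`): the same clauses, at `p = 6` instead of `8`,
with BMM's range used at its boundary `n = p/3`, and with Lemma R needed in its CM-algebra form (two lift
corners).  The ONLY conditional input is BMM Cor 2.  Nothing here says anything about the status of the
Hodge conjecture for CM abelian varieties, which is NOT proved: the theorem is the implication «printed
clauses ⇒ S4 for this face».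
-/

open Finset
open scoped Pointwise

namespace HodgeRepro.RouteC

namespace FaceC2C2C2

variable (V : Vocab C2xC2xC2 cc)

/-- **C5′ discharges the sixfold face** `A × E × E′` from exactly these clauses: BMM Cor 2 at
`(p, n) = (6, 2)`, R7 in codimension `2`, DR Lemma 3.5, Liu Cor 4.20 at rank `7`, Liu Def 4.5 + Shimura
§8.3, R5 at `p = 6`, Lemma R and the isogeny bookkeeping — then the Weil line of
`B = A_{Φ_E} × A_{Φ_A} × A_{Φ_A·(0,1,0)} × A_{Φ_{E′}}` is algebraic. -/
theorem faceC2C2C2_weilAlgebraic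
    (hbmm : V.BMM2016_Cor2 6 2) (hr7 : V.Meng2019_Lemma4_1_codim 2) (hdr : V.DR2015_Lemma3_5)
    (hliu : V.Liu2021_Cor4_20 6) (hls : V.Liu2021_Def4_5_Shimura8_3) (hr5 : V.RouteC_R5 6)
    (hR : V.RouteC_LemmaR) (hisog : V.IsogFactorMult_of_isog_pow) :
    V.WeilAlgebraic face := by
  rw [face_eq_corner]
  have H : V.Clauses 6 (Fintype.card (Fin 4) / 2) :=
    { bmm := by simpa using hbmm
      meng := by simpa using hr7
      dr := hdr
      liu := hliu
      liuShimura := hls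
      r5 := hr5
      lemmaR := hR
      isog := hisog }
  exact V.routeC_closes_face cc_C2xC2xC2_isComplexConj reps cls tw isCMType_reps
    (face_eq_corner ▸ sumTwo_face) cls_tw_injective injOn_cosetMap_reducedSet
    (by rw [Nat.card_eq_fintype_card]; decide) (p := 6)
    (by rw [sum_dim_simple]) (by simp) (by norm_num) H

/-- The same, from the bundle `Clauses 6 2`. -/
theorem faceC2C2C2_weilAlgebraic_of_clauses (H : V.Clauses 6 2) : V.WeilAlgebraic face :=
  faceC2C2C2_weilAlgebraic V H.bmm H.meng H.dr H.liu H.liuShimura H.r5 H.lemmaR H.isog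

end FaceC2C2C2

end HodgeRepro.RouteC
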